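import Literature.AnabelianGeometry.SemiGraphs.OneVertexCuspsHypotheses
import Literature.AnabelianGeometry.SemiGraphs.OneVertexEdgelessChart
import Literature.AnabelianGeometry.SemiGraphs.TemperedCuspOmission
import HarnessLib

/-!
# The EXPLICIT tempered fundamental group of a one-vertex semi-graph of anabelioids with cusps:
# `π₁^temp(OneVertexCusps.graph Π_v E emb) = Π_v` ([SemiAnbd] Prop. 3.6 (ii); [IUTchI] §2 p. 44,
# "omission of cuspidal edges does not affect the tempered fundamental group")

Mochizuki, *Semi-graphs of anabelioids*, Publ. RIMS **42** (2006) [SemiAnbd], §1 p. 13 (omitting the open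
edges), Def. 3.5 / Prop. 3.6 (ii) p. 38 (`B^temp(π₁^temp(𝒢)) ⥲ B^temp(𝒢)`) [cite: MochizukiSemiAnbd2006, Prop 3.6(ii) p.38];
Mochizuki, *Inter-universal Teichmüller theory I*, §2 p. 44 [cite: Mochizuki2012, IUTchI §2 p.44].

Sequel (abc-iut cell, layer L3, seat abc-iut-L3-t11 gen 6, step (B2) of the row «NV-hLG@cusped» /
«CUSP-ABS·NONDEGENERATE-NV») of `OneVertexCuspsHypotheses.lean`, in the pattern of abc-iut-f-177's
`WitnessIwahoriCuspChart.lean` (the one-cusp Iwahori case) but GENERIC and short, because the two inputs are now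
in the tree BY NAME: abc-iut-L3-t6's `chartSingleVertex 𝒢 v : TemperedPiChart (𝒢.restrict ⟨{v}, ∅⟩)` (group
`Π_v` on the nose, `OneVertexEdgelessChart.lean`) and the cusp-omission equivalence
`isEquivalence_btempRestrict` (`TemperedCuspOmission.lean`, abc-iut row W4-30).  For the one-vertex semi-graph of
anabelioids `OneVertexCusps.graph Π_v E emb` with cusps `e_k` (`k : ι`):

* `OneVertexCusps.cuspOmission` — the sub-semi-graph `⟨{v}, ∅⟩` (the vertex, no edge) IS a cusp omission
  (`cuspOmission_isCuspOmission`: every omitted edge `e_k` has exactly the one abutting branch `(k, true)`);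
* `OneVertexCusps.cuspOmissionEquiv : B^temp(graph) ≌ B^temp(graph|_{⟨{v}, ∅⟩})` (restriction functor on the nose);
* **`OneVertexCusps.chart Π_v E emb : TemperedPiChart (graph Π_v E emb)`** with **`(chart …).G = Π_v`**
  definitionally (`chart_G`): the vertex group itself is a tempered fundamental group of the cusped graph.

So a cusped fibre of an Example 3.10 tower can be charted by its vertex group (what the `adm`/`admKer` fields of
`SpecialFibreTower` need).  Consistency / structure only; no statement of the papers is touched; no instance, no
notation, no `Prop` fact is declared.  Nothing here bears on [IUTchIII] Cor. 3.12.
-/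

noncomputable section

open Topology CategoryTheory

namespace Literature.AnabelianGeometry.SemiGraphs

namespace OneVertexCusps

open ProfiniteSemiGraph

universe u

variable {ι : Type u} (P : Type u) [Group P] [TopologicalSpace P] [IsTopologicalGroup P] [CompactSpace P]
  [TotallyDisconnectedSpace P]
  (E : ι → Type u) [∀ k, Group (E k)] [∀ k, TopologicalSpace (E k)] [∀ k, IsTopologicalGroup (E k)]
  [∀ k, CompactSpace (E k)] [∀ k, TotallyDisconnectedSpace (E k)]
  (emb : ∀ k, E k →ₜ* P)

/-- The sub-semi-graph consisting of the vertex and no edge ("the sub-semi-graph obtained by omitting all of the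
open edges", [SemiAnbd] §1 p. 13). [cite: MochizukiSemiAnbd2006, §1 p.13] -/
def cuspOmission : (graph P E emb).graph.Subgraph := ⟨{PUnit.unit}, ∅⟩

/-- **`cuspOmission` is a cusp omission**: every vertex is kept and each omitted edge `e_k` has exactly one
abutting branch, `(k, true)`. [cite: MochizukiSemiAnbd2006, §1 p.13] -/
theorem cuspOmission_isCuspOmission : (cuspOmission P E emb).IsCuspOmission where
  verts_eq := Set.eq_univ_of_forall fun v => by cases v; exact Set.mem_singleton _
  existsUnique_abuts k _ := ⟨(k, true), rfl, rfl, fun b' hb' hab => by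
    obtain ⟨k', c⟩ := b'
    cases hb'
    cases c
    · cases hab
    · rfl⟩

/-- THE cusp-omission equivalence `B^temp(graph) ≌ B^temp(graph|_{vertex})`: the restriction functor made an
equivalence ([IUTchI] §2 p. 44; tree: `isEquivalence_btempRestrict`). [cite: Mochizuki2012, IUTchI §2 p.44] -/
def cuspOmissionEquiv :
    BTempCat (graph P E emb) ≌ BTempCat ((graph P E emb).restrict (cuspOmission P E emb)) :=
  haveI := isEquivalence_btempRestrict (cuspOmission_isCuspOmission P E emb)
  ((graph P E emb).btempRestrict (cuspOmission P E emb)).asEquivalence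

/-- Its functor is the restriction of tempered coverings (definitionally). [cite: Mochizuki2012, IUTchI §2 p.44] -/
theorem cuspOmissionEquiv_functor :
    (cuspOmissionEquiv P E emb).functor = (graph P E emb).btempRestrict (cuspOmission P E emb) := rfl

/-- **The explicit tempered fundamental group of the one-vertex graph with cusps**: `π₁^temp` may be taken to
be the vertex group `Π_v` itself — cusp omission, then abc-iut-L3-t6's chart of the edgeless single-vertex
restriction. [cite: MochizukiSemiAnbd2006, Prop 3.6(ii) p.38] -/
def chart [SecondCountableTopology P] : TemperedPiChart (graph P E emb) :=
  haveI : SecondCountableTopology ((graph P E emb).Gv PUnit.unit) := ‹SecondCountableTopology P›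
  (chartSingleVertex (graph P E emb) PUnit.unit).transport (cuspOmissionEquiv P E emb)

/-- **`π₁^temp(graph Π_v E emb) = Π_v` on the nose** (definitionally). [cite: MochizukiSemiAnbd2006, Prop 3.6(ii) p.38] -/
theorem chart_G [SecondCountableTopology P] : (chart P E emb).G = P := rfl

/-- The chart's equivalence is (cusp omission) followed by (restriction to the vertex), definitionally.
[cite: MochizukiSemiAnbd2006, Prop 3.6(ii) p.38] -/
theorem chart_equiv [SecondCountableTopology P] :
    (chart P E emb).equiv =
      (cuspOmissionEquiv P E emb).trans
        (@chartSingleVertex (graph P E emb) PUnit.unit ‹SecondCountableTopology P›).equiv := rfl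

end OneVertexCusps

end Literature.AnabelianGeometry.SemiGraphs

end
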